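import Literature.Probability.RandomPlanarGeometry.ChordalCapacityDivergence
import Literature.Probability.LatticeModels.PlanarIsing
import Literature.Probability.Percolation.BoxCrossingProofs
import HarnessLib

/-!
# Chart-annulus separation for lattice paths of a Dobrushin domain

Stub `stub_chartAnnulusSeparation` of the line `fk-anchor-transfer` for the crux
`IsingBoundaryRatio` (stmt-CriticalPhenomena-10650): the deterministic lattice input of the
FK half-annulus argument. For a Dobrushin domain `(D; a, b)` with chordal chart `φ : ℍ → D`
(`φ → a` at `0`, `φ → b` at `∞`) and chart radii `0 < ρ₁ < ρ₂`, once the mesh `δ` is small every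
path of `Ω_δ = discreteDomainGraph D δ` from a site of chart radius `‖φ⁻¹ ·‖ ≤ ρ₁` to a site of
chart radius `≥ ρ₂` visits a site of chart radius strictly between `ρ₁` and `ρ₂`.

Proof. The capped chart radius `g = min (‖φ⁻¹ ·‖) ρ₂` is continuous on `D` and has a limit from
within `D` at every boundary point (Carathéodory boundary behaviour of `φ⁻¹`, file
`ChordalCapacityDivergence`: a nonzero real limit off `{a, b}`, `0` at `a`, `∞` at `b`, where
`g → ρ₂`), so it extends continuously to the compact closure of `D` (`continuousOn_extendFrom`)
and is uniformly continuous on `D` (Heine–Cantor). Consecutive sites of a path of `Ω_δ` have mesh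
points in `D` at distance `δ` (`dist_meshPoint_of_adj`, file `Percolation/BoxCrossingProofs`); for
`δ` below the uniform-continuity modulus of `g` at `ρ₂ - ρ₁`,
the first site of the path with chart radius `> ρ₁` has `g <` (its predecessor's `g ≤ ρ₁`)
`+ (ρ₂ - ρ₁)`, i.e. chart radius `< ρ₂`.

No new definitions; every statement here is folklore lattice/topology bookkeeping.
-/

noncomputable section

open scoped Topology
open Filter Set Metric
open Literature.Probability.LatticeModels Literature.Probability.RandomPlanarGeometry
open UpperHalfPlane (upperHalfPlaneSet)

namespace Summit.CriticalPhenomena.SAWScalingLimit.Theorems.IsingBoundaryRatio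

/-! ### One step of `Ω_δ` in the plane -/

/-- A step `x ∼ y` of `Ω_δ = discreteDomainGraph Ω δ`: both endpoints have their mesh points in
`Ω` (vertices of `Ω_δ` are mesh vertices) and these are at distance at most `|δ|` (the step is a
nearest-neighbour step of `ℤ²`, `dist_meshPoint_of_adj`). [folklore] -/
theorem meshPoint_mem_of_discreteDomainGraph_adj {Ω : Set ℂ} {δ : ℝ} {x y : Site 2}
    (h : (discreteDomainGraph Ω δ).Adj x y) :
    meshPoint δ x ∈ Ω ∧ meshPoint δ y ∈ Ω ∧ dist (meshPoint δ x) (meshPoint δ y) ≤ |δ| := by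
  obtain ⟨hm, hx, hy⟩ := discreteDomainGraph_adj_iff.1 h
  exact ⟨meshDomain_subset_meshVertices Ω δ hx, meshDomain_subset_meshVertices Ω δ hy,
    (Literature.Probability.Percolation.dist_meshPoint_of_adj (meshGraph_le_zdGraph Ω δ hm)).le⟩

/-! ### The capped chart radius is uniformly continuous on `D` -/

/-- **Boundary limits of the capped chart radius.** For a chordal uniformizing map `φ` of the
Dobrushin domain `(D; a, b)` and a cap `ρ`, the capped chart radius `z ↦ min ‖φ⁻¹ z‖ ρ` has a
limit from within `D` at every point of `closure D`: at a point of `D` by continuity of `φ⁻¹`;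
at `a` the limit is `min 0 ρ` (`φ⁻¹ → 0`), at `b` it is `ρ` (`φ⁻¹ → ∞`), and at any other
boundary point it is `min |q| ρ` for the nonzero real boundary value `q` of `φ⁻¹` there
(Carathéodory). [folklore] -/
theorem exists_tendsto_min_norm_symm {D : DobrushinDomain}
    {φ : ConformalEquiv upperHalfPlaneSet D.carrier} (hφ : D.IsChordalUniformizing φ) (ρ : ℝ)
    {p : ℂ} (hp : p ∈ closure D.carrier) :
    ∃ y : ℝ, Tendsto (fun z => min ‖φ.symm z‖ ρ) (𝓝[D.carrier] p) (𝓝 y) := by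
  have hc : Continuous fun w : ℂ => min ‖w‖ ρ := continuous_norm.min continuous_const
  rw [closure_eq_self_union_frontier] at hp
  rcases hp with hp | hp
  · exact ⟨_, (hc.tendsto _).comp (φ.symm.continuousOn p hp).tendsto⟩
  · by_cases hpa : p = D.pt 0
    · subst hpa
      exact ⟨_, (hc.tendsto _).comp hφ.tendsto_symm_nhds_zero⟩
    by_cases hpb : p = D.pt 1
    · subst hpb
      refine ⟨ρ, tendsto_const_nhds.congr' ?_⟩
      have h1 : Tendsto (fun z => ‖φ.symm z‖) (𝓝[D.carrier] (D.pt 1)) atTop :=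
        tendsto_norm_cocompact_atTop.comp hφ.tendsto_symm_cocompact
      filter_upwards [h1.eventually_ge_atTop ρ] with z hz
      exact (min_eq_right hz).symm
    · obtain ⟨q, -, hq⟩ := hφ.exists_tendsto_symm_of_mem_frontier hp hpa hpb
      exact ⟨_, (hc.tendsto _).comp hq⟩

/-- **Uniform continuity of the capped chart radius.** For a chordal uniformizing map `φ` of a
Dobrushin domain `D`, a cap `ρ` and `θ > 0` there is `η > 0` such that
`|min ‖φ⁻¹ z‖ ρ - min ‖φ⁻¹ z'‖ ρ| < θ` for all `z, z' ∈ D` with `dist z z' < η`: the capped chart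
radius extends continuously to the compact set `closure D` (`exists_tendsto_min_norm_symm`,
`continuousOn_extendFrom`), where it is uniformly continuous (Heine–Cantor). [folklore] -/
theorem exists_forall_dist_min_norm_symm_lt {D : DobrushinDomain}
    {φ : ConformalEquiv upperHalfPlaneSet D.carrier} (hφ : D.IsChordalUniformizing φ) (ρ : ℝ)
    {θ : ℝ} (hθ : 0 < θ) :
    ∃ η : ℝ, 0 < η ∧ ∀ z ∈ D.carrier, ∀ z' ∈ D.carrier, dist z z' < η →
      dist (min ‖φ.symm z‖ ρ) (min ‖φ.symm z'‖ ρ) < θ := by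
  have hK : IsCompact (closure D.carrier) := D.isBounded.isCompact_closure
  have hG : ContinuousOn (extendFrom D.carrier fun z => min ‖φ.symm z‖ ρ) (closure D.carrier) :=
    continuousOn_extendFrom Subset.rfl fun p hp => exists_tendsto_min_norm_symm hφ ρ hp
  have hg : ContinuousOn (fun z => min ‖φ.symm z‖ ρ) D.carrier :=
    (continuous_norm.min continuous_const).comp_continuousOn φ.symm.continuousOn
  obtain ⟨η, hη, h⟩ :=
    Metric.uniformContinuousOn_iff.1 (hK.uniformContinuousOn_of_continuous hG) θ hθ
  refine ⟨η, hη, fun z hz z' hz' hzz' => ?_⟩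
  have key := h z (subset_closure hz) z' (subset_closure hz') hzz'
  rwa [extendFrom_extends hg z hz, extendFrom_extends hg z' hz'] at key

/-! ### The walk argument -/

/-- **First crossing of a chart level along a lattice path.** Let `f : ℂ → ℂ`, `ρ₁ < ρ₂`, and
suppose the capped radius `min ‖f ·‖ ρ₂` varies by less than `ρ₂ - ρ₁` between points of `Ω` at
distance `< η`. If `|δ| < η`, every walk of `Ω_δ` from a site `u` with `‖f (δu)‖ ≤ ρ₁` to a site
`v` with `ρ₂ ≤ ‖f (δv)‖` contains a site `z` with `ρ₁ < ‖f (δz)‖ < ρ₂`: the first site of the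
walk with `‖f‖ > ρ₁` (induction along the walk; a nil walk contradicts `ρ₁ < ρ₂`). [folklore] -/
theorem exists_mem_support_norm_mem_Ioo {Ω : Set ℂ} {δ η ρ₁ ρ₂ : ℝ} {f : ℂ → ℂ}
    (hδ : |δ| < η) (h12 : ρ₁ < ρ₂)
    (hη : ∀ z ∈ Ω, ∀ z' ∈ Ω, dist z z' < η → dist (min ‖f z‖ ρ₂) (min ‖f z'‖ ρ₂) < ρ₂ - ρ₁) :
    ∀ {u v : Site 2} (w : (discreteDomainGraph Ω δ).Walk u v),
      ‖f (meshPoint δ u)‖ ≤ ρ₁ → ρ₂ ≤ ‖f (meshPoint δ v)‖ →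
        ∃ z ∈ w.support, ρ₁ < ‖f (meshPoint δ z)‖ ∧ ‖f (meshPoint δ z)‖ < ρ₂ := by
  intro u v w
  induction w with
  | nil =>
    intro hu hv
    exact absurd (hu.trans_lt (h12.trans_le hv)) (lt_irrefl _)
  | @cons a b c hab p ih =>
    intro hu hv
    rcases le_or_gt ‖f (meshPoint δ b)‖ ρ₁ with hb | hb
    · obtain ⟨z, hz, hz'⟩ := ih hb hv
      refine ⟨z, ?_, hz'⟩
      rw [SimpleGraph.Walk.support_cons]
      exact List.mem_cons_of_mem _ hz
    · obtain ⟨ha, hb', hd⟩ := meshPoint_mem_of_discreteDomainGraph_adj hab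
      have hθ := hη _ ha _ hb' (hd.trans_lt hδ)
      rw [Real.dist_eq] at hθ
      have h1 : min ‖f (meshPoint δ a)‖ ρ₂ ≤ ρ₁ := (min_le_left _ _).trans hu
      have h2 : min ‖f (meshPoint δ b)‖ ρ₂ < ρ₂ := by
        have h3 := (abs_lt.1 hθ).1
        linarith
      refine ⟨b, ?_, hb, (min_lt_iff.1 h2).resolve_right (lt_irrefl _)⟩
      rw [SimpleGraph.Walk.support_cons]
      exact List.mem_cons_of_mem _ p.start_mem_support

/-! ### The stub -/

/-- **Chart-annulus separation** (registered stub `stub_chartAnnulusSeparation` of the line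
`fk-anchor-transfer`, = `ChartAnnulusSeparation`): in the chordal chart `φ : ℍ → D` of a
Dobrushin domain (`φ(0) = a`, `φ(∞) = b`), for `0 < ρ₁ < ρ₂` and all small mesh sizes `δ > 0`,
every path of `Ω_δ = discreteDomainGraph D δ` from a site of chart radius `‖φ⁻¹ ·‖ ≤ ρ₁` to a
site of chart radius `≥ ρ₂` passes through a site of chart radius in `(ρ₁, ρ₂)`. Consecutive
sites of the path have mesh points in `D` at distance `δ`, and the capped chart radius
`min (‖φ⁻¹ ·‖) ρ₂` is uniformly continuous on `D` (`exists_forall_dist_min_norm_symm_lt`); take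
`δ` below its modulus at `ρ₂ - ρ₁` and the first site of the path with chart radius `> ρ₁`
(`exists_mem_support_norm_mem_Ioo`). [folklore] -/
theorem stub_chartAnnulusSeparation :
    ∀ (D : DobrushinDomain) (φ : ConformalEquiv UpperHalfPlane.upperHalfPlaneSet D.carrier),
      D.IsChordalUniformizing φ → ∀ (ρ₁ ρ₂ : ℝ), 0 < ρ₁ → ρ₁ < ρ₂ →
        ∀ᶠ δ in 𝓝[>] (0 : ℝ), ∀ (u v : Site 2) (w : (discreteDomainGraph D.carrier δ).Walk u v),
          ‖φ.symm (meshPoint δ u)‖ ≤ ρ₁ → ρ₂ ≤ ‖φ.symm (meshPoint δ v)‖ →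
            ∃ z ∈ w.support, ρ₁ < ‖φ.symm (meshPoint δ z)‖ ∧ ‖φ.symm (meshPoint δ z)‖ < ρ₂ := by
  intro D φ hφ ρ₁ ρ₂ _ h12
  obtain ⟨η, hη, h⟩ := exists_forall_dist_min_norm_symm_lt hφ ρ₂ (sub_pos.2 h12)
  filter_upwards [Ioo_mem_nhdsGT hη] with δ hδ u v w hu hv
  exact exists_mem_support_norm_mem_Ioo (by rw [abs_of_pos hδ.1]; exact hδ.2) h12 h w hu hv

end Summit.CriticalPhenomena.SAWScalingLimit.Theorems.IsingBoundaryRatio
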